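import Summits.Ventures.PercRepro.RLSGenericT1Sums

/-!
# C-025 at q = 3: the pair-witness sums at type t = 1 (night-3)

For the dependent-witness analysis (plan §4) at type `t = 1` (outside points `p − 1 = n + 3`): the witnesses containing a fixed
N-parallel pair `{y,y′}` number `C(p − 1 − 2, x − 2)` at level `x`; the near-pencil subsets over the pair's line lose the tie share
`1/(x+1)` there and the `(k-line) ∪ {a,a′}` subsets lose their share 1.  Hence the two sums `pwSum n = Σ_{x=2}^{p−4} C(p−1−2, x−2)`
(`= 2^{N} − Σ_{y<3} C(N,y)`, `N = n + 3 − 2`) and `ptSum n = Σ_{x=2}^{p−4} C(p−1−2, x−2)/(x+1)` (closed form through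
`C(N,i)/(i+3) = C(N+3,i+3)(i+1)(i+2)/((N+1)(N+2)(N+3))` and three level sums), with their explicit rational forms.  No `decide`.
-/

open PercRepro.NightThree.CF

namespace PercRepro.NightThree.U1

open Finset

/-- `Σ_{y<1} C(N,y) = 1`. -/
theorem sum_range_one' (N : ℕ) : (∑ y ∈ range 1, (N.choose y : ℚ)) = 1 := by simp

/-- `Σ_{y<3} C(N,y) = 1 + N + C(N,2)`. -/
theorem sum_range_three' (N : ℕ) : (∑ y ∈ range 3, (N.choose y : ℚ)) = 1 + N + (N.choose 2 : ℚ) := by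
  simp [sum_range_succ]

/-- `Σ_{x=2}^{p−4} C(p−1−2, x−2)` (`x = i + 2`, `i < n − 1`). -/
def pwSum (n : ℕ) : ℚ := ∑ i ∈ range (n - 1), ((n + 1).choose i : ℚ)

/-- `Σ_{x=2}^{p−4} C(p−1−2, x−2)/(x+1)`. -/
def ptSum (n : ℕ) : ℚ := ∑ i ∈ range (n - 1), ((n + 1).choose i : ℚ) / ((i : ℚ) + 3)

/-- `pwSum n = 2^N − Σ_{y<3} C(N,y)`, `N = n + 3 − 2`. -/
theorem pw_closed (n : ℕ) (hn : 1 ≤ n) : pwSum n = 2 ^ (n + 1) - (1 + ((n : ℚ) + 1) + ((n + 1).choose 2 : ℚ)) := by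
  unfold pwSum
  rw [range_eq_Ico, sum_choose_Ico (n + 1) 0 (n - 1) (by omega) (by omega)]
  have ht := sum_choose_tail (n + 1) 3 (by omega)
  rw [show (n + 1) + 1 - 3 = n - 1 by omega] at ht
  rw [ht, sum_range_three']; simp

/-- `Σ_{i<n−1} C(N+1, i+1)`. -/
theorem level_one (n : ℕ) (hn : 1 ≤ n) :
    (∑ i ∈ range (n - 1), ((n + 2).choose (i + 1) : ℚ)) = 2 ^ (n + 2) - (1) - (1 + ((n : ℚ) + 2) + ((n + 2).choose 2 : ℚ)) := by
  rw [sum_choose_shift (n + 2) 1 (n - 1), sum_choose_Ico (n + 2) 1 (1 + (n - 1)) (by omega) (by omega)]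
  have ht := sum_choose_tail (n + 2) 3 (by omega)
  rw [show n + 2 + 1 - 3 = 1 + (n - 1) by omega] at ht
  rw [ht, sum_range_one', sum_range_three']; push_cast; ring

/-- `Σ_{i<n−1} C(N+2, i+2)`. -/
theorem level_two (n : ℕ) (hn : 1 ≤ n) :
    (∑ i ∈ range (n - 1), ((n + 3).choose (i + 2) : ℚ)) = 2 ^ (n + 3) - (1 + ((n : ℚ) + 3)) - (1 + ((n : ℚ) + 3) + ((n + 3).choose 2 : ℚ)) := by
  rw [sum_choose_shift (n + 3) 2 (n - 1), sum_choose_Ico (n + 3) 2 (2 + (n - 1)) (by omega) (by omega)]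
  have ht := sum_choose_tail (n + 3) 3 (by omega)
  rw [show n + 3 + 1 - 3 = 2 + (n - 1) by omega] at ht
  rw [ht, sum_range_two, sum_range_three']; push_cast; ring

/-- `Σ_{i<n−1} C(N+3, i+3)`. -/
theorem level_three (n : ℕ) (hn : 1 ≤ n) :
    (∑ i ∈ range (n - 1), ((n + 4).choose (i + 3) : ℚ)) = 2 ^ (n + 4) - (1 + ((n : ℚ) + 4) + ((n + 4).choose 2 : ℚ)) - (1 + ((n : ℚ) + 4) + ((n + 4).choose 2 : ℚ)) := by
  rw [sum_choose_shift (n + 4) 3 (n - 1), sum_choose_Ico (n + 4) 3 (3 + (n - 1)) (by omega) (by omega)]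
  have ht := sum_choose_tail (n + 4) 3 (by omega)
  rw [show n + 4 + 1 - 3 = 3 + (n - 1) by omega] at ht
  rw [ht, sum_range_three']; push_cast; ring

/-- Termwise: `C(N,i)/(i+3)·(N+1)(N+2)(N+3) = (N+3)(N+2)·C(N+1,i+1) − 2(N+3)·C(N+2,i+2) + 2·C(N+3,i+3)`. -/
theorem pt_term (n i : ℕ) :
    ((n + 1).choose i : ℚ) / ((i : ℚ) + 3) =
      ((((n : ℚ) + 1) + 3) * (((n : ℚ) + 1) + 2) * (((n + 1) + 1).choose (i + 1) : ℚ) - 2 * (((n : ℚ) + 1) + 3) * (((n + 1) + 2).choose (i + 2) : ℚ)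
        + 2 * (((n + 1) + 3).choose (i + 3) : ℚ)) / ((((n : ℚ) + 1) + 1) * (((n : ℚ) + 1) + 2) * (((n : ℚ) + 1) + 3)) := by
  have h1 := Nat.add_one_mul_choose_eq (n + 1) i
  have h2 := Nat.add_one_mul_choose_eq ((n + 1) + 1) (i + 1)
  have h3 := Nat.add_one_mul_choose_eq ((n + 1) + 2) (i + 2)
  have e1 : (((n : ℚ) + 1) + 1) * ((n + 1).choose i : ℚ) = (((n + 1) + 1).choose (i + 1) : ℚ) * ((i : ℚ) + 1) := by exact_mod_cast h1
  have e2 : (((n : ℚ) + 1) + 2) * (((n + 1) + 1).choose (i + 1) : ℚ) = (((n + 1) + 2).choose (i + 2) : ℚ) * ((i : ℚ) + 2) := by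
    rw [show (n + 1) + 1 + 1 = (n + 1) + 2 by omega, show i + 1 + 1 = i + 2 by omega] at h2; exact_mod_cast h2
  have e3 : (((n : ℚ) + 1) + 3) * (((n + 1) + 2).choose (i + 2) : ℚ) = (((n + 1) + 3).choose (i + 3) : ℚ) * ((i : ℚ) + 3) := by
    rw [show (n + 1) + 2 + 1 = (n + 1) + 3 by omega, show i + 2 + 1 = i + 3 by omega] at h3; exact_mod_cast h3
  have hi : ((i : ℚ) + 3) ≠ 0 := by positivity
  have hN : ((((n : ℚ) + 1) + 1) * (((n : ℚ) + 1) + 2) * (((n : ℚ) + 1) + 3)) ≠ 0 := by positivity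
  rw [div_eq_div_iff hi hN]
  linear_combination ((((n : ℚ) + 1) + 2) * (((n : ℚ) + 1) + 3)) * e1 - (2 * (((n : ℚ) + 1) + 3)) * e2 + 2 * e3

/-- `ptSum` in closed form. -/
theorem pt_closed (n : ℕ) (hn : 1 ≤ n) :
    ptSum n = ((((n : ℚ) + 1) + 3) * (((n : ℚ) + 1) + 2) * (2 ^ (n + 2) - (1) - (1 + ((n : ℚ) + 2) + ((n + 2).choose 2 : ℚ)))
      - 2 * (((n : ℚ) + 1) + 3) * (2 ^ (n + 3) - (1 + ((n : ℚ) + 3)) - (1 + ((n : ℚ) + 3) + ((n + 3).choose 2 : ℚ)))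
      + 2 * (2 ^ (n + 4) - (1 + ((n : ℚ) + 4) + ((n + 4).choose 2 : ℚ)) - (1 + ((n : ℚ) + 4) + ((n + 4).choose 2 : ℚ)))) / ((((n : ℚ) + 1) + 1) * (((n : ℚ) + 1) + 2) * (((n : ℚ) + 1) + 3)) := by
  unfold ptSum
  rw [sum_congr rfl (fun i _ => pt_term n i), ← sum_div, sum_add_distrib, sum_sub_distrib, ← mul_sum, ← mul_sum, ← mul_sum]
  rw [level_one n hn, level_two n hn, level_three n hn]

/-- `pwSum` as a rational function. -/
def pwP (n : ℕ) : ℚ := 2 * 2 ^ n - (1 + ((n : ℚ) + 1) + ((n : ℚ) + 1) * (n : ℚ) / 2)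

/-- `ptSum` as a rational function. -/
def ptP (n : ℕ) : ℚ :=
  ((((n : ℚ) + 1) + 3) * (((n : ℚ) + 1) + 2) * (4 * 2 ^ n - (1) - (1 + ((n : ℚ) + 2) + ((n : ℚ) + 2) * ((n : ℚ) + 1) / 2))
      - 2 * (((n : ℚ) + 1) + 3) * (8 * 2 ^ n - (1 + ((n : ℚ) + 3)) - (1 + ((n : ℚ) + 3) + ((n : ℚ) + 3) * ((n : ℚ) + 2) / 2))
      + 2 * (16 * 2 ^ n - (1 + ((n : ℚ) + 4) + ((n : ℚ) + 4) * ((n : ℚ) + 3) / 2) - (1 + ((n : ℚ) + 4) + ((n : ℚ) + 4) * ((n : ℚ) + 3) / 2))) / ((((n : ℚ) + 1) + 1) * (((n : ℚ) + 1) + 2) * (((n : ℚ) + 1) + 3))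

/-- `pwSum` as an explicit rational function (`n ≥ 1`). -/
theorem pw_eq_P (n : ℕ) (hn : 1 ≤ n) : pwSum n = pwP n := by
  rw [pw_closed n hn]; unfold pwP
  simp only [choose_two_cast]
  push_cast
  rw [pow_add]
  ring_nf

/-- `ptSum` as an explicit rational function (`n ≥ 1`). -/
theorem pt_eq_P (n : ℕ) (hn : 1 ≤ n) : ptSum n = ptP n := by
  rw [pt_closed n hn]; unfold ptP
  simp only [choose_two_cast]
  push_cast
  rw [pow_add, pow_add, pow_add]
  ring_nf

end PercRepro.NightThree.U1
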